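import Summits.BirchSwinnertonDyer.Rank2.Family81517NodeQuadratic
import Summits.BirchSwinnertonDyer.Rank2.IntModelNodeRootCriterion
import Literature.NumberTheory.EllipticCurves.RootNumberTwistProofs
import Literature.NumberTheory.EllipticCurves.DegreeConjectureAbcPrelims
import Literature.NumberTheory.EllipticCurves.SzpiroLocalDataProofs
import HarnessLib

/-!
# The `8-15-17` family: local root numbers of the member `E : y² + xy = x³ + A x² + q r x`

Cell `bsd-rank2` (D-0036), seat `bsd-rank2-eng` GEN 8 — kernel 3 of the T-r3₂ support
`Summit.BirchSwinnertonDyer.Rank2.LambdaTransportDoor.RootNumberFacts` (claimed on the cell bus 2026-08-27 11:17Z).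
Parameters as in `Rank2/Family81517Conductor.lean`: primes `m ≡ 3 (mod 8)`, `q = m + 64n²`, `r = m + 289n²`,
`60 ∣ n ≠ 0`, `4A = −17q − 1`; integer model `W₀ = ⟨1, A, 0, qr, 0⟩`, `Δ = 225 m q³ r²`, `c₄ = q(241m + 4624n²)`.

* §1 `family81517_natGenerator_of_bad` — a bad place lies over `3, 5, m, q, r`; `w_v = +1` at the good places.
* §2 multiplicative places `ℓ ∈ {3, 5, m, r}` (`ℓ ∥ N`): `E` is SPLIT at `ℓ` iff the node discriminant
  `D = −17q³(241m + 4624n²)(217m − 2312n²)` (`Family81517NodeQuadratic`) is a square mod `ℓ`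
  (`IntModelNodeRootCriterion`), i.e. iff `m ≡ 1 (3)` / `m ≡ ±1 (5)` / `(34/m) = 1` / `(17/r) = 1`;
  `w_ℓ = −1` exactly then (Rohrlich 1993 Prop. 2(ii)).
* §3 the additive place `q` (Kodaira III: `v_q(Δ) = 3`, `v_q(c₄) ≥ 1`, `e = 12/gcd(3,12) = 4`):
  `w_q = (−2/q) = χ₈'(q) = +1` since `q ≡ 3 (mod 8)` (Rohrlich 1993 Prop. 2(iv), tree
  `localRootNumber_padic_of_e_eq_four_holds` over `ℤ_q`, transported by `localRootNumberAt_eq_localRootNumber_padic`).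

THEOREMS ONLY; no `sorry`; standard axioms. PARTITION: none — r_an ≥ 2, summit axis S0; TWIN (D-0056): n/a. B1 honesty:
local-sign bookkeeping on the explicit family; nothing reads r_an; no S0 motion.

References: D. Rohrlich, *Compositio Math.* 87 (1993) Prop. 2 [Rohrlich1993Compositio]; J. H. Silverman, *AEC* (2009)
VII.5 Prop. 5.1 [SilvermanAEC2009].
-/

set_option linter.dupNamespace false

noncomputable section

open IsDedekindDomain IsDedekindDomain.HeightOneSpectrum WeierstrassCurve Rat.HeightOneSpectrum
  Literature.NumberTheory.EllipticCurves IsDiscreteValuationRing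

namespace Summit.BirchSwinnertonDyer.Rank2

section LocalRootNumbers

variable {m q r : ℕ} {n A : ℤ}

/-! ### §1 Bad places; good places -/

/-- A bad place of `W₀ ⊗ ℚ` lies over one of `3, 5, m, q, r`. [folklore] -/
theorem family81517_natGenerator_of_bad (hm : m.Prime) (hq : q.Prime) (hr : r.Prime)
    (hq_eq : (q : ℤ) = m + 64 * n ^ 2) (hr_eq : (r : ℤ) = m + 289 * n ^ 2) (hA : 4 * A = -17 * q - 1)
    {v : HeightOneSpectrum ℤ}
    (h : v.valuation ℚ ((⟨1, A, 0, (q : ℤ) * r, 0⟩ : WeierstrassCurve ℤ).baseChange ℚ).Δ < 1) :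
    natGenerator v = 3 ∨ natGenerator v = 5 ∨ natGenerator v = m ∨ natGenerator v = q ∨ natGenerator v = r := by
  rw [baseChange_int_Δ, Literature.NumberTheory.EllipticCurves.Rat.valuation_intCast_lt_one_iff] at h
  exact family81517_eq_of_prime_dvd_Δ hm hq hr hq_eq hr_eq hA (prime_natGenerator v) h

/-- `w_v = +1` at a place of good reduction (`v(Δ) = 1`). [cite: Rohrlich1993Compositio, Prop. 2(i)] -/
theorem localRootNumberAt_family81517_good (hm : m.Prime) (hq : q.Prime) (hr : r.Prime)
    (hq_eq : (q : ℤ) = m + 64 * n ^ 2) (hr_eq : (r : ℤ) = m + 289 * n ^ 2) (hA : 4 * A = -17 * q - 1)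
    {v : HeightOneSpectrum ℤ}
    (h : v.valuation ℚ ((⟨1, A, 0, (q : ℤ) * r, 0⟩ : WeierstrassCurve ℤ).baseChange ℚ).Δ = 1) :
    ((⟨1, A, 0, (q : ℤ) * r, 0⟩ : WeierstrassCurve ℤ).baseChange ℚ).localRootNumberAt v = 1 :=
  haveI := isElliptic_baseChange_family81517 hm hq hr hq_eq hr_eq hA
  WeierstrassCurve.localRootNumberAt_of_hasGoodReductionAt
    (hasGoodReductionAt_of_valuation_Δ_eq_one_holds v _ (isIntegralAt_baseChange_int v _) h)

/-! ### §2 The multiplicative places `3, 5, m, r` -/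

/-- `ℓ ∤ c₄` for `ℓ ∈ {3, 5, m, r}`. [folklore] -/
theorem family81517_not_dvd_c₄ (hm : m.Prime) (hq : q.Prime) (hr : r.Prime) (hn : n ≠ 0) (h60 : (60 : ℤ) ∣ n)
    (hm8 : m % 8 = 3) (hm3 : m ≠ 3)
    (hq_eq : (q : ℤ) = m + 64 * n ^ 2) (hr_eq : (r : ℤ) = m + 289 * n ^ 2) (hA : 4 * A = -17 * q - 1)
    {ℓ : ℕ} (hℓ : ℓ = 3 ∨ ℓ = 5 ∨ ℓ = m ∨ ℓ = r) :
    ¬ (ℓ : ℤ) ∣ (⟨1, A, 0, (q : ℤ) * r, 0⟩ : WeierstrassCurve ℤ).c₄ := by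
  rcases hℓ with h | h | h | h
  · subst h
    exact family81517_not_dvd_c₄_of_dvd_n hm hq hn hq_eq hr_eq hA (Or.inl rfl) (dvd_trans ⟨20, by norm_num⟩ h60) hm3
  · subst h
    exact family81517_not_dvd_c₄_of_dvd_n hm hq hn hq_eq hr_eq hA (Or.inr rfl) (dvd_trans ⟨12, by norm_num⟩ h60)
      (by omega)
  · rw [h]; exact family81517_not_m_dvd_c₄ hm hq hn hm8 hq_eq hr_eq hA
  · rw [h]; exact family81517_not_r_dvd_c₄ hm hq hr hn hq_eq hr_eq hA

/-- **Multiplicative reduction above `3, 5, m, r`** (`ℓ ∣ Δ`, `ℓ ∤ c₄`). [cite: SilvermanAEC2009, VII.5 Prop. 5.1(b)] -/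
theorem hasMultiplicativeReductionAt_family81517 (hm : m.Prime) (hq : q.Prime) (hr : r.Prime) (hn : n ≠ 0)
    (h60 : (60 : ℤ) ∣ n) (hm8 : m % 8 = 3) (hm3 : m ≠ 3)
    (hq_eq : (q : ℤ) = m + 64 * n ^ 2) (hr_eq : (r : ℤ) = m + 289 * n ^ 2) (hA : 4 * A = -17 * q - 1)
    {ℓ : ℕ} (hℓ : ℓ = 3 ∨ ℓ = 5 ∨ ℓ = m ∨ ℓ = r) {v : HeightOneSpectrum ℤ} (hv : natGenerator v = ℓ) :
    haveI := isElliptic_baseChange_family81517 hm hq hr hq_eq hr_eq hA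
    ((⟨1, A, 0, (q : ℤ) * r, 0⟩ : WeierstrassCurve ℤ).baseChange ℚ).HasMultiplicativeReductionAt v := by
  haveI := isElliptic_baseChange_family81517 hm hq hr hq_eq hr_eq hA
  refine hasMultiplicativeReductionAt_of_valuation_c₄_eq_one (isIntegralAt_baseChange_int v _) ?_ ?_
  · rw [baseChange_int_c₄, Literature.NumberTheory.EllipticCurves.Rat.valuation_intCast_eq_one_iff, hv]
    exact family81517_not_dvd_c₄ hm hq hr hn h60 hm8 hm3 hq_eq hr_eq hA hℓ
  · rw [baseChange_int_Δ, Literature.NumberTheory.EllipticCurves.Rat.valuation_intCast_lt_one_iff, hv]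
    exact family81517_dvd_Δ hq_eq hr_eq hA (by rcases hℓ with h | h | h | h <;> simp [h])

/-- **SPLIT at `ℓ ∈ {3, 5, m, r}` iff the node discriminant `D = −17q³(241m + 4624n²)(217m − 2312n²)` is a
square mod `ℓ`.** [cite: SilvermanAEC2009, VII.5 Prop. 5.1(b)] -/
theorem hasSplitMultiplicativeReductionAt_family81517_iff (hm : m.Prime) (hq : q.Prime) (hr : r.Prime)
    (hn : n ≠ 0) (h60 : (60 : ℤ) ∣ n) (hm8 : m % 8 = 3) (hm3 : m ≠ 3)
    (hq_eq : (q : ℤ) = m + 64 * n ^ 2) (hr_eq : (r : ℤ) = m + 289 * n ^ 2) (hA : 4 * A = -17 * q - 1)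
    {ℓ : ℕ} (hℓ : ℓ = 3 ∨ ℓ = 5 ∨ ℓ = m ∨ ℓ = r) {v : HeightOneSpectrum ℤ} (hv : natGenerator v = ℓ) :
    haveI := isElliptic_baseChange_family81517 hm hq hr hq_eq hr_eq hA
    ((⟨1, A, 0, (q : ℤ) * r, 0⟩ : WeierstrassCurve ℤ).baseChange ℚ).HasSplitMultiplicativeReductionAt v ↔
      IsSquare (((-17 * (q : ℤ) ^ 3 * (241 * m + 4624 * n ^ 2) * (217 * m - 2312 * n ^ 2) : ℤ)) : ZMod ℓ) := by
  haveI := isElliptic_baseChange_family81517 hm hq hr hq_eq hr_eq hA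
  have hℓp : ℓ.Prime := by
    rcases hℓ with rfl | rfl | rfl | rfl
    · norm_num
    · norm_num
    · exact hm
    · exact hr
  haveI : Fact ℓ.Prime := ⟨hℓp⟩
  obtain ⟨hmq, hqr, hmr⟩ := family81517_lt hn hq_eq hr_eq
  have hℓ2 : ℓ ≠ 2 := by
    have := hm.two_le
    rcases hℓ with h | h | h | h <;> omega
  have hc₄ := family81517_not_dvd_c₄ hm hq hr hn h60 hm8 hm3 hq_eq hr_eq hA hℓ
  have hΔ : (natGenerator v : ℤ) ∣ (⟨1, A, 0, (q : ℤ) * r, 0⟩ : WeierstrassCurve ℤ).Δ := by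
    rw [hv]; exact family81517_dvd_Δ hq_eq hr_eq hA (by rcases hℓ with h | h | h | h <;> simp [h])
  have hc₄' : ¬ (natGenerator v : ℤ) ∣ (⟨1, A, 0, (q : ℤ) * r, 0⟩ : WeierstrassCurve ℤ).c₄ := by rwa [hv]
  rw [hasSplitMultiplicativeReductionAt_int_iff_exists_root _ v hΔ hc₄', hv, exists_root_iff_isSquare_disc hℓ2 hc₄]
  have hD := family81517_nodeDisc hq_eq hr_eq hA
  simp only at hD
  have ha1 : (⟨1, A, 0, (q : ℤ) * r, 0⟩ : WeierstrassCurve ℤ).a₁ = 1 := rfl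
  have ha2 : (⟨1, A, 0, (q : ℤ) * r, 0⟩ : WeierstrassCurve ℤ).a₂ = A := rfl
  rw [ha1, ha2, one_mul, hD]

/-- `IsSquare (a·x²) ↔ IsSquare a` for `x ≠ 0` in a field. [folklore] -/
theorem isSquare_mul_sq_iff {F : Type*} [Field F] {a x : F} (hx : x ≠ 0) : IsSquare (a * x ^ 2) ↔ IsSquare a := by
  constructor
  · rintro ⟨y, hy⟩
    refine ⟨y / x, ?_⟩
    field_simp
    linear_combination hy
  · rintro ⟨z, hz⟩
    exact ⟨z * x, by rw [hz]; ring⟩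

/-- At `3` (`3 ∣ n`, `m ≠ 3`): `D ≡ m` is a square mod `3` iff `m ≡ 1 (mod 3)`. [cite: Rohrlich1993Compositio, Prop. 2(ii)] -/
theorem family81517_isSquare_nodeDisc_three_iff (hm : m.Prime) (hm3 : m ≠ 3) (hq_eq : (q : ℤ) = m + 64 * n ^ 2)
    (h3 : (3 : ℤ) ∣ n) :
    IsSquare (((-17 * (q : ℤ) ^ 3 * (241 * m + 4624 * n ^ 2) * (217 * m - 2312 * n ^ 2) : ℤ)) : ZMod 3) ↔
      m % 3 = 1 := by
  rw [family81517_nodeDisc_mod_three hq_eq h3, ← ZMod.natCast_mod m 3]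
  have hm3' : ¬ 3 ∣ m := fun h ↦ hm3 ((Nat.prime_dvd_prime_iff_eq Nat.prime_three hm).mp h).symm
  obtain h | h : m % 3 = 1 ∨ m % 3 = 2 := by omega
  · rw [h]; exact ⟨fun _ ↦ rfl, fun _ ↦ by decide⟩
  · rw [h]; exact ⟨fun hs ↦ absurd hs (by decide), fun h' ↦ by omega⟩

/-- At `5` (`5 ∣ n`, `m ≠ 5`): `D ≡ m` is a square mod `5` iff `m ≡ ±1 (mod 5)`. [cite: Rohrlich1993Compositio, Prop. 2(ii)] -/
theorem family81517_isSquare_nodeDisc_five_iff (hm : m.Prime) (hm5 : m ≠ 5) (hq_eq : (q : ℤ) = m + 64 * n ^ 2)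
    (h5 : (5 : ℤ) ∣ n) :
    IsSquare (((-17 * (q : ℤ) ^ 3 * (241 * m + 4624 * n ^ 2) * (217 * m - 2312 * n ^ 2) : ℤ)) : ZMod 5) ↔
      (m % 5 = 1 ∨ m % 5 = 4) := by
  rw [family81517_nodeDisc_mod_five hq_eq h5, ← ZMod.natCast_mod m 5]
  have hm5' : ¬ 5 ∣ m := fun h ↦ hm5 ((Nat.prime_dvd_prime_iff_eq Nat.prime_five hm).mp h).symm
  obtain h | h | h | h : m % 5 = 1 ∨ m % 5 = 2 ∨ m % 5 = 3 ∨ m % 5 = 4 := by omega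
  · rw [h]; exact ⟨fun _ ↦ Or.inl rfl, fun _ ↦ by decide⟩
  · rw [h]; exact ⟨fun hs ↦ absurd hs (by decide), fun h' ↦ by omega⟩
  · rw [h]; exact ⟨fun hs ↦ absurd hs (by decide), fun h' ↦ by omega⟩
  · rw [h]; exact ⟨fun _ ↦ Or.inr rfl, fun _ ↦ by decide⟩

/-- At `m`: `D ≡ 34·(2¹²17²n⁵)²` is a square mod `m` iff `(34/m) = 1` (`m` odd, `m ≠ 17`, `m ∤ n`).
[cite: Rohrlich1993Compositio, Prop. 2(ii)] -/
theorem family81517_isSquare_nodeDisc_m_iff (hm : m.Prime) (hq : q.Prime) (hn : n ≠ 0) (hm8 : m % 8 = 3)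
    (hq_eq : (q : ℤ) = m + 64 * n ^ 2) (hr_eq : (r : ℤ) = m + 289 * n ^ 2) :
    haveI : Fact m.Prime := ⟨hm⟩
    IsSquare (((-17 * (q : ℤ) ^ 3 * (241 * m + 4624 * n ^ 2) * (217 * m - 2312 * n ^ 2) : ℤ)) : ZMod m) ↔
      legendreSym m 34 = 1 := by
  haveI : Fact m.Prime := ⟨hm⟩
  rw [family81517_nodeDisc_mod_m hq_eq]
  have hK : (1183744 : ZMod m) ≠ 0 := by
    intro h
    have h' : m ∣ 2 ^ 12 * 17 ^ 2 := (ZMod.natCast_eq_zero_iff 1183744 m).mp (by exact_mod_cast h)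
    rcases (Nat.Prime.dvd_mul hm).mp h' with h2 | h17
    · have := (Nat.prime_dvd_prime_iff_eq hm Nat.prime_two).mp (hm.dvd_of_dvd_pow h2); omega
    · have := (Nat.prime_dvd_prime_iff_eq hm (by norm_num)).mp (hm.dvd_of_dvd_pow h17); omega
  have hnm : ((n : ℤ) : ZMod m) ≠ 0 := by
    rw [Ne, ZMod.intCast_zmod_eq_zero_iff_dvd]; exact family81517_not_m_dvd_n hm hq hn hq_eq hr_eq
  have h34 : ((34 : ℤ) : ZMod m) ≠ 0 := by
    intro h
    have h' : m ∣ 2 * 17 := (ZMod.natCast_eq_zero_iff 34 m).mp (by exact_mod_cast h)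
    rcases (Nat.Prime.dvd_mul hm).mp h' with h2 | h17
    · have := (Nat.prime_dvd_prime_iff_eq hm Nat.prime_two).mp h2; omega
    · have := (Nat.prime_dvd_prime_iff_eq hm (by norm_num)).mp h17; omega
  rw [isSquare_mul_sq_iff (mul_ne_zero hK (pow_ne_zero _ hnm)), legendreSym.eq_one_iff m h34]
  push_cast; rfl

/-- At `r`: `D ≡ 17·(3⁵5⁵17²n⁵)²` is a square mod `r` iff `(17/r) = 1` (`r ≥ 291`, `r ∤ n`).
[cite: Rohrlich1993Compositio, Prop. 2(ii)] -/
theorem family81517_isSquare_nodeDisc_r_iff (hm : m.Prime) (hr : r.Prime) (hn : n ≠ 0)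
    (hq_eq : (q : ℤ) = m + 64 * n ^ 2) (hr_eq : (r : ℤ) = m + 289 * n ^ 2) :
    haveI : Fact r.Prime := ⟨hr⟩
    IsSquare (((-17 * (q : ℤ) ^ 3 * (241 * m + 4624 * n ^ 2) * (217 * m - 2312 * n ^ 2) : ℤ)) : ZMod r) ↔
      legendreSym r 17 = 1 := by
  haveI : Fact r.Prime := ⟨hr⟩
  obtain ⟨-, -, hmr⟩ := family81517_lt hn hq_eq hr_eq
  have hr17 : 17 < r := by have := hm.two_le; omega
  rw [family81517_nodeDisc_mod_r hq_eq hr_eq]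
  have hK : (219459375 : ZMod r) ≠ 0 := by
    intro h
    have h' : r ∣ 3 ^ 5 * 5 ^ 5 * 17 ^ 2 := (ZMod.natCast_eq_zero_iff 219459375 r).mp (by exact_mod_cast h)
    rcases (Nat.Prime.dvd_mul hr).mp h' with h35 | h17
    · rcases (Nat.Prime.dvd_mul hr).mp h35 with h3 | h5
      · have := (Nat.prime_dvd_prime_iff_eq hr Nat.prime_three).mp (hr.dvd_of_dvd_pow h3); omega
      · have := (Nat.prime_dvd_prime_iff_eq hr Nat.prime_five).mp (hr.dvd_of_dvd_pow h5); omega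
    · have := (Nat.prime_dvd_prime_iff_eq hr (by norm_num)).mp (hr.dvd_of_dvd_pow h17); omega
  have hnr : ((n : ℤ) : ZMod r) ≠ 0 := by
    rw [Ne, ZMod.intCast_zmod_eq_zero_iff_dvd]; exact family81517_not_r_dvd_n hm hn hq_eq hr_eq
  have h17 : ((17 : ℤ) : ZMod r) ≠ 0 := by
    intro h
    have h' : r ∣ 17 := (ZMod.natCast_eq_zero_iff 17 r).mp (by exact_mod_cast h)
    have := (Nat.prime_dvd_prime_iff_eq hr (by norm_num)).mp h'; omega
  rw [isSquare_mul_sq_iff (mul_ne_zero hK (pow_ne_zero _ hnr)), legendreSym.eq_one_iff r h17]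
  push_cast; rfl

open scoped Classical in
/-- **`w_ℓ` at `ℓ ∈ {3, 5, m, r}`: `−1` iff split iff `D` is a square mod `ℓ`.** [cite: Rohrlich1993Compositio, Prop. 2(ii)] -/
theorem localRootNumberAt_family81517_mult (hm : m.Prime) (hq : q.Prime) (hr : r.Prime) (hn : n ≠ 0)
    (h60 : (60 : ℤ) ∣ n) (hm8 : m % 8 = 3) (hm3 : m ≠ 3)
    (hq_eq : (q : ℤ) = m + 64 * n ^ 2) (hr_eq : (r : ℤ) = m + 289 * n ^ 2) (hA : 4 * A = -17 * q - 1)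
    {ℓ : ℕ} (hℓ : ℓ = 3 ∨ ℓ = 5 ∨ ℓ = m ∨ ℓ = r) {v : HeightOneSpectrum ℤ} (hv : natGenerator v = ℓ) :
    ((⟨1, A, 0, (q : ℤ) * r, 0⟩ : WeierstrassCurve ℤ).baseChange ℚ).localRootNumberAt v =
      if IsSquare (((-17 * (q : ℤ) ^ 3 * (241 * m + 4624 * n ^ 2) * (217 * m - 2312 * n ^ 2) : ℤ)) : ZMod ℓ)
      then -1 else 1 := by
  haveI := isElliptic_baseChange_family81517 hm hq hr hq_eq hr_eq hA
  have hiff := hasSplitMultiplicativeReductionAt_family81517_iff hm hq hr hn h60 hm8 hm3 hq_eq hr_eq hA hℓ hv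
  by_cases hs : IsSquare (((-17 * (q : ℤ) ^ 3 * (241 * m + 4624 * n ^ 2) * (217 * m - 2312 * n ^ 2) : ℤ)) : ZMod ℓ)
  · rw [if_pos hs]
    exact localRootNumberAt_of_hasSplitMultiplicativeReductionAt (hiff.mpr hs)
  · rw [if_neg hs]
    exact localRootNumberAt_of_hasMultiplicativeReductionAt_of_not_split
      (hasMultiplicativeReductionAt_family81517 hm hq hr hn h60 hm8 hm3 hq_eq hr_eq hA hℓ hv) (mt hiff.mp hs)

/-! ### §3 The additive place `q`: Kodaira III, `e = 4`, `w_q = χ₈'(q) = +1` -/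

/-- An integer prime to `p` is a unit of `ℤ_p`. [folklore] -/
theorem isUnit_padicInt_intCast {p : ℕ} [Fact p.Prime] {k : ℤ} (hk : ¬ (p : ℤ) ∣ k) : IsUnit (k : ℤ_[p]) := by
  rw [PadicInt.isUnit_iff]
  have h1 := PadicInt.norm_le_one (k : ℤ_[p])
  have h2 : ¬ ‖(k : ℤ_[p])‖ < 1 := by rwa [PadicInt.norm_int_lt_one_iff_dvd]
  exact le_antisymm h1 (not_lt.mp h2)

/-- `q ≡ 3 (mod 8)`, `5 ≤ q`, `q ≠ m`, `q ≠ r`, `q ∤ 225 m r²`. [folklore] -/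
theorem family81517_q_facts (hm : m.Prime) (hq : q.Prime) (hr : r.Prime) (hn : n ≠ 0) (hm8 : m % 8 = 3)
    (hq_eq : (q : ℤ) = m + 64 * n ^ 2) (hr_eq : (r : ℤ) = m + 289 * n ^ 2) :
    q % 8 = 3 ∧ 5 ≤ q ∧ ¬ (q : ℤ) ∣ 225 * m * (r : ℤ) ^ 2 := by
  obtain ⟨hmq, hqr, -⟩ := family81517_lt hn hq_eq hr_eq
  have h2 := hm.two_le
  have hq8 : q % 8 = 3 := by
    have e : (q : ℤ) % 8 = 3 := by
      rw [hq_eq, show (64 : ℤ) * n ^ 2 = 8 * (8 * n ^ 2) by ring, Int.add_mul_emod_self_left]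
      exact_mod_cast hm8
    omega
  refine ⟨hq8, by omega, fun h ↦ ?_⟩
  rcases Int.Prime.dvd_mul' hq h with h1 | h1
  · rcases Int.Prime.dvd_mul' hq h1 with h3 | h3
    · have h4 : q ∣ 3 ^ 2 * 5 ^ 2 := by exact_mod_cast h3
      rcases (Nat.Prime.dvd_mul hq).mp h4 with h5 | h5
      · have := (Nat.prime_dvd_prime_iff_eq hq Nat.prime_three).mp (hq.dvd_of_dvd_pow h5); omega
      · have := (Nat.prime_dvd_prime_iff_eq hq Nat.prime_five).mp (hq.dvd_of_dvd_pow h5); omega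
    · have := (Nat.prime_dvd_prime_iff_eq hq hm).mp (Int.natCast_dvd_natCast.mp h3); omega
  · have := (Nat.prime_dvd_prime_iff_eq hq hr).mp (Int.natCast_dvd_natCast.mp (Int.Prime.dvd_pow' hq h1)); omega

/-- **`w_q = +1` over `ℤ_q`**: the `ℤ_q`-minimal model of `E` (the integer model itself) is additive with
`v_q(Δ) = 3`, `v_q(c₄) ≥ 1`, so `e = 4` and `w_q = χ₈'(q) = 1` (`q ≡ 3 mod 8`). [cite: Rohrlich1993Compositio, Prop. 2(iv)] -/
theorem localRootNumber_padic_family81517_q (hm : m.Prime) (hq : q.Prime) (hr : r.Prime) (hn : n ≠ 0)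
    (hm8 : m % 8 = 3)
    (hq_eq : (q : ℤ) = m + 64 * n ^ 2) (hr_eq : (r : ℤ) = m + 289 * n ^ 2) (hA : 4 * A = -17 * q - 1) :
    haveI : Fact q.Prime := ⟨hq⟩
    (((⟨1, A, 0, (q : ℤ) * r, 0⟩ : WeierstrassCurve ℤ).baseChange ℚ).baseChange ℚ_[q]).localRootNumber ℤ_[q] = 1 := by
  haveI : Fact q.Prime := ⟨hq⟩
  haveI := isElliptic_baseChange_family81517 hm hq hr hq_eq hr_eq hA
  obtain ⟨hq8, hq5, hqunit⟩ := family81517_q_facts hm hq hr hn hm8 hq_eq hr_eq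
  set W₀ : WeierstrassCurve ℤ := ⟨1, A, 0, (q : ℤ) * r, 0⟩ with hW₀
  set E := W₀.baseChange ℚ with hE
  set Wp := E.baseChange ℚ_[q] with hWp
  haveI : Wp.IsElliptic := by rw [hWp]; change (E.map _).IsElliptic; infer_instance
  -- the place of `ℤ` under `q`
  set v : HeightOneSpectrum ℤ := (primesEquiv (R := ℤ)).symm ⟨q, hq⟩ with hv
  have hgv : natGenerator v = q := Literature.NumberTheory.EllipticCurves.Rat.natGenerator_primesEquiv_symm ⟨q, hq⟩
  have hpv : ((primesEquiv v : Nat.Primes) : ℕ) = q := by rw [hv, Equiv.apply_symm_apply]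
  -- `E ⊗ ℚ_q` is `ℤ_q`-minimal (`q¹² ∤ Δ`)
  have hminv : E.IsMinimalAt v := isMinimalAt_family81517 hm hq hr hq_eq hr_eq hA v
  haveI hmin : Wp.IsMinimal ℤ_[q] := (isMinimalAt_iff_isMinimal_padic v q hpv E).mp hminv
  -- additive reduction at `q` (`q ∣ Δ`, `q ∣ c₄`)
  have haddv : E.HasAdditiveReductionAt v := by
    rw [hasAdditiveReductionAt_iff_of_isMinimalAt hminv, hE, baseChange_int_Δ, baseChange_int_c₄,
      Literature.NumberTheory.EllipticCurves.Rat.valuation_intCast_lt_one_iff,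
      Literature.NumberTheory.EllipticCurves.Rat.valuation_intCast_lt_one_iff, hgv]
    exact ⟨family81517_dvd_Δ hq_eq hr_eq hA (by simp), family81517_q_dvd_c₄ hq_eq hr_eq hA⟩
  have hadd : (Wp.minimal ℤ_[q]).HasAdditiveReduction ℤ_[q] :=
    (E.hasAdditiveReduction_padic_iff_hasAdditiveReductionAt_int ⟨q, hq⟩).mpr haddv
  -- the integral model has the integer invariants
  have inj := IsFractionRing.injective ℤ_[q] ℚ_[q]
  have hΔi : (Wp.integralModel ℤ_[q]).Δ = (W₀.Δ : ℤ_[q]) := inj <| by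
    rw [integralModel_Δ_eq, hWp, hE, WeierstrassCurve.baseChange, map_Δ, baseChange_int_Δ]; simp
  have hc₄i : (Wp.integralModel ℤ_[q]).c₄ = (W₀.c₄ : ℤ_[q]) := inj <| by
    rw [integralModel_c₄_eq, hWp, hE, WeierstrassCurve.baseChange, map_c₄, baseChange_int_c₄]; simp
  obtain ⟨C, hC⟩ : ∃ C : VariableChange ℚ_[q], Wp.minimal ℤ_[q] = C • Wp := ⟨_, rfl⟩
  have hq1 : addVal ℤ_[q] (q : ℤ_[q]) = 1 := addVal_uniformizer PadicInt.irreducible_p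
  have hvΔ : addVal ℤ_[q] ((Wp.minimal ℤ_[q]).integralModel ℤ_[q]).Δ = 3 := by
    rw [addVal_Δ_integralModel_eq_of_isMinimal_of_eq_smul ℤ_[q] hC, hΔi, hW₀, family81517Int_Δ hq_eq hr_eq hA,
      show (((225 * m * (q : ℤ) ^ 3 * (r : ℤ) ^ 2 : ℤ)) : ℤ_[q]) = ((225 * m * (r : ℤ) ^ 2 : ℤ) : ℤ_[q]) * (q : ℤ_[q]) ^ 3 by
        push_cast; ring,
      addVal_mul, addVal_pow, hq1, addVal_eq_zero_iff.mpr (isUnit_padicInt_intCast hqunit)]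
    rfl
  have hvc₄ : 1 ≤ addVal ℤ_[q] ((Wp.minimal ℤ_[q]).integralModel ℤ_[q]).c₄ := by
    rw [addVal_c₄_integralModel_eq_of_isMinimal_of_eq_smul ℤ_[q] hC Wp.isUnit_Δ.ne_zero, hc₄i, hW₀,
      family81517Int_c₄ hq_eq hr_eq hA,
      show ((((q : ℤ) * (241 * m + 4624 * n ^ 2) : ℤ)) : ℤ_[q]) = (q : ℤ_[q]) * ((241 * m + 4624 * n ^ 2 : ℤ) : ℤ_[q]) by
        push_cast; ring,
      addVal_mul, hq1]
    exact le_self_add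
  rw [Literature.NumberTheory.EllipticCurves.localRootNumber_padic_of_hasAdditiveReduction q Wp hq5 hadd, hvΔ,
    if_neg (by rw [not_lt]; calc (3 : ℕ∞) = 3 * 1 := by norm_num
      _ ≤ 3 * _ := by gcongr),
    if_neg (by decide), if_neg (by decide), ZMod.χ₈'_nat_eq_if_mod_eight, if_neg (by omega), if_pos (Or.inr hq8)]

/-- **`w_q = +1` at the place over `q`.** [cite: Rohrlich1993Compositio, Prop. 2(iv)] -/
theorem localRootNumberAt_family81517_q (hm : m.Prime) (hq : q.Prime) (hr : r.Prime) (hn : n ≠ 0)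
    (hm8 : m % 8 = 3)
    (hq_eq : (q : ℤ) = m + 64 * n ^ 2) (hr_eq : (r : ℤ) = m + 289 * n ^ 2) (hA : 4 * A = -17 * q - 1)
    {v : HeightOneSpectrum ℤ} (hv : natGenerator v = q) :
    ((⟨1, A, 0, (q : ℤ) * r, 0⟩ : WeierstrassCurve ℤ).baseChange ℚ).localRootNumberAt v = 1 := by
  haveI := isElliptic_baseChange_family81517 hm hq hr hq_eq hr_eq hA
  subst hv
  rw [localRootNumberAt_eq_localRootNumber_padic _ v]
  exact localRootNumber_padic_family81517_q hm (prime_natGenerator v) hr hn hm8 hq_eq hr_eq hA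

/-! ### §4 All local root numbers -/

open scoped Classical in
/-- **The local root numbers of the member**: `w_v = −1` iff `v` lies over `ℓ ∈ {3, 5, m, r}` with `D` a square
mod `ℓ`; `w_v = +1` at `q`, at the non-split places and at the good places. [cite: Rohrlich1993Compositio, Prop. 2] -/
theorem localRootNumberAt_family81517 (hm : m.Prime) (hq : q.Prime) (hr : r.Prime) (hn : n ≠ 0)
    (h60 : (60 : ℤ) ∣ n) (hm8 : m % 8 = 3) (hm3 : m ≠ 3)
    (hq_eq : (q : ℤ) = m + 64 * n ^ 2) (hr_eq : (r : ℤ) = m + 289 * n ^ 2) (hA : 4 * A = -17 * q - 1)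
    (v : HeightOneSpectrum ℤ) :
    ((⟨1, A, 0, (q : ℤ) * r, 0⟩ : WeierstrassCurve ℤ).baseChange ℚ).localRootNumberAt v =
      if (natGenerator v = 3 ∨ natGenerator v = 5 ∨ natGenerator v = m ∨ natGenerator v = r) ∧
          IsSquare (((-17 * (q : ℤ) ^ 3 * (241 * m + 4624 * n ^ 2) * (217 * m - 2312 * n ^ 2) : ℤ)) :
            ZMod (natGenerator v))
      then -1 else 1 := by
  haveI := isElliptic_baseChange_family81517 hm hq hr hq_eq hr_eq hA
  obtain ⟨hmq, hqr, hmr⟩ := family81517_lt hn hq_eq hr_eq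
  have hm5 : m ≠ 5 := by omega
  rcases (WeierstrassCurve.valuation_Δ_le_one_of_isIntegralAt (isIntegralAt_baseChange_int v
    (⟨1, A, 0, (q : ℤ) * r, 0⟩ : WeierstrassCurve ℤ))).eq_or_lt with h | h
  · -- good place
    have hnd : ¬ (natGenerator v = 3 ∨ natGenerator v = 5 ∨ natGenerator v = m ∨ natGenerator v = r) := by
      rw [baseChange_int_Δ, Literature.NumberTheory.EllipticCurves.Rat.valuation_intCast_eq_one_iff] at h
      intro hℓ
      exact h (family81517_dvd_Δ hq_eq hr_eq hA (by rcases hℓ with h | h | h | h <;> simp [h]))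
    rw [if_neg (not_and_of_not_left _ hnd)]
    exact localRootNumberAt_family81517_good hm hq hr hq_eq hr_eq hA h
  · rcases family81517_natGenerator_of_bad hm hq hr hq_eq hr_eq hA h with hp | hp | hp | hp | hp
    · rw [localRootNumberAt_family81517_mult hm hq hr hn h60 hm8 hm3 hq_eq hr_eq hA (Or.inl rfl) hp, hp]
      simp
    · rw [localRootNumberAt_family81517_mult hm hq hr hn h60 hm8 hm3 hq_eq hr_eq hA (Or.inr (Or.inl rfl)) hp, hp]
      simp
    · rw [localRootNumberAt_family81517_mult hm hq hr hn h60 hm8 hm3 hq_eq hr_eq hA (Or.inr (Or.inr (Or.inl rfl))) hp,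
        hp]
      simp
    · have hne : ¬ (natGenerator v = 3 ∨ natGenerator v = 5 ∨ natGenerator v = m ∨ natGenerator v = r) := by omega
      rw [if_neg (not_and_of_not_left _ hne)]
      exact localRootNumberAt_family81517_q hm hq hr hn hm8 hq_eq hr_eq hA hp
    · rw [localRootNumberAt_family81517_mult hm hq hr hn h60 hm8 hm3 hq_eq hr_eq hA (Or.inr (Or.inr (Or.inr rfl))) hp,
        hp]
      simp

end LocalRootNumbers

end Summit.BirchSwinnertonDyer.Rank2

end
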